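import Mathlib
import HarnessLib
import Literature.NumberTheory.Automorphic.CompletedCohomology
import Literature.NumberTheory.Automorphic.Eigenvariety

/-!
# Level bookkeeping for R′ = `ParityBlindBianchi.ArtinWeightRealisationLevel` (stmt-Langlands-15111),
line `Sketch` (every-place-by-gamma-rigidity) — helper file (`--supports`)

The route-local crux R′ pins a tame level by a finite set of rational primes `S₀ ∋ p` and asks for
Hansen association at EVERY good place (a place of `K` over no prime of `S₀`); the shared crux R
(`RuelleTorsionArtinWeight.ArtinWeightRealisation`, stmt-Langlands-11057) asks for SOME finite set
`S` of places of `K` containing the places over `p`.  This file proves the bookkeeping transfer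
`levelToAE`: for `0 ∉ S₀`, the hypothesis package of R′ implies that of R with `S :=` the finitely
many places of `K` over the primes of `S₀` (`Ideal.finite_factors`), the same level `U` and
uniformisers, and the eigenvalue family re-indexed along `{v // v ∉ S} × Fin 2 ≃ {v // v good} × Fin 2`.
The re-indexing is harmless because the big Hecke algebra is the closure of the algebra generated
by the RANGE of the Hecke family: `isHeckePoint_comp_equiv` (with `towerHeckeAlgebra_comp_equiv`,
`bigHeckeAlgebra_comp_equiv`), stated for the accepted `IsHeckePoint` of
`Literature/NumberTheory/Automorphic/CompletedCohomology`.  (For `0 ∈ S₀` no place is good and no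
such `S` exists — the degenerate sector of R′, handled separately by the lead's composition.)
No definitions; pure bookkeeping. Statements are written out in full (the packages are the
hypothesis of `ParityBlindBianchi.ArtinWeightRealisationLevel` and of
`RuelleTorsionArtinWeight.ArtinWeightRealisation` verbatim).
-/

noncomputable section

open scoped BigOperators Topology Classical Matrix NumberField
open Literature.NumberTheory.Automorphic Literature.NumberTheory.GaloisRepresentations
  IsDedekindDomain NumberField Filter

universe u v

-- `Summit.Langlands.Langlands.…`: summit = sub-problem name (D-0017 nested layout), not a typo.
set_option linter.dupNamespace false

namespace Summit.Langlands.Langlands.Theorems.ArtinWeightRealisationLevel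

section Reindex

variable {k : Type u} [CommRing k] {Γ 𝒢 : Type u} [Group Γ] [Group 𝒢]
  (ι : Γ →* 𝒢) (T : LevelTower 𝒢) (ϖ : k) {J J' : Type v}

/-- Re-indexing the generating Hecke family along an equivalence does not change the tower Hecke
algebra (it is generated by the RANGE of the family). [folklore] -/
theorem towerHeckeAlgebra_comp_equiv (e : J' ≃ J) (δ : J → 𝒢) :
    towerHeckeAlgebra k ι T ϖ (δ ∘ e) = towerHeckeAlgebra k ι T ϖ δ := by
  unfold towerHeckeAlgebra
  congr 1
  ext x
  simp only [Set.mem_range, Function.comp_apply]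
  constructor
  · rintro ⟨j, rfl⟩
    exact ⟨e j, rfl⟩
  · rintro ⟨j, rfl⟩
    exact ⟨e.symm j, by simp⟩

/-- Re-indexing the generating Hecke family along an equivalence does not change the big Hecke
algebra. [folklore] -/
theorem bigHeckeAlgebra_comp_equiv (e : J' ≃ J) (δ : J → 𝒢) :
    bigHeckeAlgebra k ι T ϖ (δ ∘ e) = bigHeckeAlgebra k ι T ϖ δ := by
  ext x
  change (∀ I : Finset TowerIndex, ∃ a ∈ towerHeckeAlgebra k ι T ϖ (δ ∘ e), ∀ y ∈ I, x y = a y) ↔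
    (∀ I : Finset TowerIndex, ∃ a ∈ towerHeckeAlgebra k ι T ϖ δ, ∀ y ∈ I, x y = a y)
  rw [towerHeckeAlgebra_comp_equiv]

/-- **`IsHeckePoint` is invariant under re-indexing the Hecke family (and the eigenvalue system)
along an equivalence of index types.** [folklore] -/
theorem isHeckePoint_comp_equiv (e : J' ≃ J) (δ : J → 𝒢) (χ : J → k) :
    IsHeckePoint ι T ϖ (δ ∘ e) (χ ∘ e) ↔ IsHeckePoint ι T ϖ δ χ := by
  have hB := bigHeckeAlgebra_comp_equiv ι T ϖ e δ
  constructor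
  · intro h t
    obtain ⟨I, φ, hcont, hgen⟩ := h t
    refine ⟨I, φ.comp (Subalgebra.equivOfEq _ _ hB.symm).toAlgHom, ?_, ?_⟩
    · intro x y hxy
      simp only [AlgHom.comp_apply]
      apply hcont
      intro z hz
      simpa using hxy z hz
    · intro j
      have h1 : ((Subalgebra.equivOfEq _ _ hB.symm).toAlgHom
          ⟨towerHeckeFamily k ι T ϖ (δ j), towerHeckeFamily_mem_bigHeckeAlgebra k ι T ϖ δ j⟩ :
            bigHeckeAlgebra k ι T ϖ (δ ∘ e)) =
          ⟨towerHeckeFamily k ι T ϖ ((δ ∘ e) (e.symm j)),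
            towerHeckeFamily_mem_bigHeckeAlgebra k ι T ϖ (δ ∘ e) (e.symm j)⟩ := by
        apply Subtype.ext
        simp
      have h2 := hgen (e.symm j)
      simp only [Function.comp_apply, Equiv.apply_symm_apply] at h2
      rw [AlgHom.comp_apply, h1]
      simpa using h2
  · intro h t
    obtain ⟨I, φ, hcont, hgen⟩ := h t
    refine ⟨I, φ.comp (Subalgebra.equivOfEq _ _ hB).toAlgHom, ?_, ?_⟩
    · intro x y hxy
      simp only [AlgHom.comp_apply]
      apply hcont
      intro z hz
      simpa using hxy z hz
    · intro j
      have h1 : ((Subalgebra.equivOfEq _ _ hB).toAlgHom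
          ⟨towerHeckeFamily k ι T ϖ ((δ ∘ e) j), towerHeckeFamily_mem_bigHeckeAlgebra k ι T ϖ (δ ∘ e) j⟩ :
            bigHeckeAlgebra k ι T ϖ δ) =
          ⟨towerHeckeFamily k ι T ϖ (δ (e j)), towerHeckeFamily_mem_bigHeckeAlgebra k ι T ϖ δ (e j)⟩ := by
        apply Subtype.ext
        simp
      rw [AlgHom.comp_apply, h1]
      exact hgen (e j)


end Reindex

/-- **Level bookkeeping `R′ ⇒ R` on the hypothesis side.**  For `K` a number field, `p` prime,
`σ : Γ_K → GL₂(ℚ̄_p)`, and a finite set of rational primes `S₀` with `p ∈ S₀` and `0 ∉ S₀`: if `σ`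
is `p`-adically automorphic of tame level `S₀` in the sense of
`ParityBlindBianchi.ArtinWeightRealisationLevel` (its hypothesis package verbatim: `U` open,
hyperspecial at every good place, uniformisers `ϖ`, an `𝒪_{ℚ̄_p}`-valued eigenvalue family `a` at the
good places forming a continuous point of the big Hecke algebra of the `p`-power tower, and Hansen
association with `σ` at every good place), then it is `p`-adically automorphic of SOME `S`-good tame
level in the sense of `RuelleTorsionArtinWeight.ArtinWeightRealisation` (its hypothesis package
verbatim), namely with `S :=` the finitely many places of `K` over the primes of `S₀`
(`Ideal.finite_factors`; this is where `0 ∉ S₀` is used), the same `U`, `ϖ`, and `a` re-indexed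
along `{v // v ∉ S} ≃ {v // v good}` (`isHeckePoint_comp_equiv`). [folklore] -/
theorem levelToAE : ∀ (K : Type) [Field K] [NumberField K] (p : ℕ) [Fact p.Prime] (σ : FramedGaloisRep K (PadicAlgCl p) 2) (S₀ : Finset ℕ), p ∈ S₀ → 0 ∉ S₀ → (∃ (U : Subgroup (GL (Fin 2) (FiniteAdeleRing (𝓞 K) K))) (ϖ : ∀ v : HeightOneSpectrum (𝓞 K), (v.adicCompletion K)ˣ) (a : {v : HeightOneSpectrum (𝓞 K) // ∀ ℓ ∈ S₀, ((ℓ : ℕ) : 𝓞 K) ∉ v.asIdeal} → ℕ → (Valued.v (R := PadicAlgCl p)).valuationSubring), IsOpen (U : Set (GL (Fin 2) (FiniteAdeleRing (𝓞 K) K))) ∧ U ≤ glFiniteIntegralLevel 2 K ∧ (∀ g ∈ glFiniteIntegralLevel 2 K, (∀ v : HeightOneSpectrum (𝓞 K), ¬ (∀ ℓ ∈ S₀, ((ℓ : ℕ) : 𝓞 K) ∉ v.asIdeal) → ∀ i j : Fin 2, ((g : Matrix (Fin 2) (Fin 2) (FiniteAdeleRing (𝓞 K) K)) i j) v = (1 :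 Matrix (Fin 2) (Fin 2) (v.adicCompletion K)) i j) → g ∈ U) ∧ (∀ v : HeightOneSpectrum (𝓞 K), Valued.v ((ϖ v : (v.adicCompletion K)ˣ) : v.adicCompletion K) = WithZero.exp (-1 : ℤ)) ∧ IsHeckePoint (Matrix.GeneralLinearGroup.map (n := Fin 2) (algebraMap K (FiniteAdeleRing (𝓞 K) K))) (LevelTower.ofSeq U (fun r : ℕ => (principalCongruenceLevel 2 K (Ideal.span {((p : ℕ) : 𝓞 K)} ^ r)).map (GLn.sndHom 2 K))) ((p : ℕ) : (Valued.v (R := PadicAlgCl p)).valuationSubring) (fun j : {v : HeightOneSpectrum (𝓞 K) // ∀ ℓ ∈ S₀, ((ℓ : ℕ) : 𝓞 K) ∉ v.asIdeal} × Fin 2 => GLn.sndHom 2 K (heckeDiagAt 2 K j.1.1 (ϖ j.1.1) (j.2.val + 1))) (fun j => a j.1 (j.2.val + 1)) ∧ ∀ (v : HeightOneSpectrum (𝓞 K)) (hv : ∀ ℓ ∈ S₀, ((ℓ : ℕ) : 𝓞 K) ∉ v.asIdeal), σ.IsHeckeAssociatedAt v (fun i : ℕ => if i = 0 then (1 : PadicAlgCl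 p) else ((a ⟨v, hv⟩ i : (Valued.v (R := PadicAlgCl p)).valuationSubring) : PadicAlgCl p))) → ∃ (S : Finset (HeightOneSpectrum (𝓞 K))) (U : Subgroup (GL (Fin 2) (FiniteAdeleRing (𝓞 K) K))) (ϖ : ∀ v : HeightOneSpectrum (𝓞 K), (v.adicCompletion K)ˣ) (a : {v : HeightOneSpectrum (𝓞 K) // v ∉ S} → ℕ → (Valued.v (R := PadicAlgCl p)).valuationSubring), (∀ v : HeightOneSpectrum (𝓞 K), ((p : ℕ) : 𝓞 K) ∈ v.asIdeal → v ∈ S) ∧ IsOpen (U : Set (GL (Fin 2) (FiniteAdeleRing (𝓞 K) K))) ∧ U ≤ glFiniteIntegralLevel 2 K ∧ (∀ g ∈ glFiniteIntegralLevel 2 K, (∀ v ∈ S, ∀ i j : Fin 2, ((g : Matrix (Fin 2) (Fin 2) (FiniteAdeleRing (𝓞 K) K)) i j) v = (1 : Matrix (Fin 2) (Fin 2) (v.adicCompletion K)) i j) → g ∈ U) ∧ (∀ v : HeightOneSpectrum (𝓞 K), Valued.v ((ϖ v : (v.adicCompletion K)ˣ) : v.adicCompletion K) = WithZero.exp (-1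 : ℤ)) ∧ IsHeckePoint (Matrix.GeneralLinearGroup.map (n := Fin 2) (algebraMap K (FiniteAdeleRing (𝓞 K) K))) (LevelTower.ofSeq U (fun r : ℕ => (principalCongruenceLevel 2 K (Ideal.span {((p : ℕ) : 𝓞 K)} ^ r)).map (GLn.sndHom 2 K))) ((p : ℕ) : (Valued.v (R := PadicAlgCl p)).valuationSubring) (fun j : {v : HeightOneSpectrum (𝓞 K) // v ∉ S} × Fin 2 => GLn.sndHom 2 K (heckeDiagAt 2 K j.1.1 (ϖ j.1.1) (j.2.val + 1))) (fun j => a j.1 (j.2.val + 1)) ∧ ∀ (v : HeightOneSpectrum (𝓞 K)) (hv : v ∉ S), σ.IsHeckeAssociatedAt v (fun i : ℕ => if i = 0 then (1 : PadicAlgCl p) else ((a ⟨v, hv⟩ i : (Valued.v (R := PadicAlgCl p)).valuationSubring) : PadicAlgCl p)) := by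
  intro K _ _ p _ σ S₀ hp h0 h
  obtain ⟨U, ϖ, a, hopen, hle, hlev, hϖ, hpt, hassoc⟩ := h
  -- the finite set of bad places (those over a prime of `S₀`; finite because `0 ∉ S₀`)
  have hfin : {v : HeightOneSpectrum (𝓞 K) | ¬ ∀ ℓ ∈ S₀, ((ℓ : ℕ) : 𝓞 K) ∉ v.asIdeal}.Finite := by
    have hsub : {v : HeightOneSpectrum (𝓞 K) | ¬ ∀ ℓ ∈ S₀, ((ℓ : ℕ) : 𝓞 K) ∉ v.asIdeal} ⊆
        ⋃ ℓ ∈ (S₀ : Set ℕ), {v : HeightOneSpectrum (𝓞 K) | v.asIdeal ∣ Ideal.span {((ℓ : ℕ) : 𝓞 K)}} := by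
      intro v hv
      simp only [Set.mem_setOf_eq, not_forall, not_not, exists_prop] at hv
      obtain ⟨ℓ, hℓ, hmem⟩ := hv
      simp only [Set.mem_iUnion, Set.mem_setOf_eq, exists_prop]
      exact ⟨ℓ, hℓ, Ideal.dvd_span_singleton.mpr hmem⟩
    refine Set.Finite.subset (Set.Finite.biUnion S₀.finite_toSet fun ℓ hℓ => ?_) hsub
    apply Ideal.finite_factors
    have hℓ0 : ℓ ≠ 0 := fun h => h0 (h ▸ hℓ)
    intro hbot
    rw [Submodule.zero_eq_bot, Ideal.span_singleton_eq_bot] at hbot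
    exact (Nat.cast_ne_zero.mpr hℓ0) hbot
  have hS : ∀ v : HeightOneSpectrum (𝓞 K), v ∉ hfin.toFinset ↔ ∀ ℓ ∈ S₀, ((ℓ : ℕ) : 𝓞 K) ∉ v.asIdeal := by
    intro v
    rw [Set.Finite.mem_toFinset, Set.mem_setOf_eq, not_not]
  -- the re-indexing equivalence `{v // v ∉ S} × Fin 2 ≃ {v // v good} × Fin 2`
  let e : {v : HeightOneSpectrum (𝓞 K) // v ∉ hfin.toFinset} × Fin 2 ≃
      {v : HeightOneSpectrum (𝓞 K) // ∀ ℓ ∈ S₀, ((ℓ : ℕ) : 𝓞 K) ∉ v.asIdeal} × Fin 2 :=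
    (Equiv.subtypeEquivRight hS).prodCongr (Equiv.refl _)
  have key := (isHeckePoint_comp_equiv
      (Matrix.GeneralLinearGroup.map (n := Fin 2) (algebraMap K (FiniteAdeleRing (𝓞 K) K)))
      (LevelTower.ofSeq U (fun r : ℕ =>
        (principalCongruenceLevel 2 K (Ideal.span {((p : ℕ) : 𝓞 K)} ^ r)).map (GLn.sndHom 2 K)))
      ((p : ℕ) : (Valued.v (R := PadicAlgCl p)).valuationSubring) e
      (fun j : {v : HeightOneSpectrum (𝓞 K) // ∀ ℓ ∈ S₀, ((ℓ : ℕ) : 𝓞 K) ∉ v.asIdeal} × Fin 2 =>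
        GLn.sndHom 2 K (heckeDiagAt 2 K j.1.1 (ϖ j.1.1) (j.2.val + 1)))
      (fun j => a j.1 (j.2.val + 1))).mpr hpt
  refine ⟨hfin.toFinset, U, ϖ, fun v => a ⟨v.1, (hS v.1).mp v.2⟩, ?_, hopen, hle, ?_, hϖ, key, ?_⟩
  · intro v hpv
    by_contra hvS
    exact (hS v).mp hvS p hp hpv
  · intro g hg hgS
    refine hlev g hg fun v hv => hgS v ?_
    by_contra hvS
    exact hv ((hS v).mp hvS)
  · intro v hv
    exact hassoc v ((hS v).mp hv)

end Summit.Langlands.Langlands.Theorems.ArtinWeightRealisationLevel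

end
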